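/-
Copyright (c) 2026 the pub-hodgecm-mathlib formalisation cell (harness21).  Prover seat hodgecm-mathlib-K2E5-p16 (g4): Track B «K2-LIT»,
hLiu418 = stmt-HodgeConjecture-24832, director req649 (S2) ∕ LEAD F0P6-plan (g11) deal of record 2026-09-04T05:23:13Z + LEAD box «=»
05:31:34Z = organ Φ6a of ROAD Φ (ruling «M-155l» §2; CENSUS-41 row Φ6): FIBRES file of the Siegel–Gindikin integral on `Herm₂(ℂ)⁺`; 2026-09-04.
-/
import Summits.HodgeConjecture.HodgeConjecture.Theorems.K2LiuHermTwoGammaDefs   -- ★ p857639 (this seat): `hermTwoGamma`, `hermTwo` + API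
import Mathlib.Analysis.SpecialFunctions.Gaussian.FourierTransform
import Mathlib.MeasureTheory.Integral.Prod
import Mathlib.LinearAlgebra.Complex.FiniteDimensional
import HarnessLib

/-!
# Crux `HLiu418`, ROAD Φ, organ Φ6a — FIBRES of the Siegel–Gindikin integral on `Herm₂(ℂ)⁺`
# (the `b`-, `z`- and `(z,b)`-fibres of `1_{x>0} e^{−tr(x y)} (det x)^{s−2}` in the chart `x = [[a, z],[z̄, b]]`, with integrability)

Cell `hodgecm-mathlib`, crux item hLiu418 = `stmt-HodgeConjecture-24832`, route of record `HCCMUnconditional`; squad K2, LEAD F0P6-plan (g11)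
(deal req649 (S2); LEAD box «=» GO AS REPORTED 05:31:34Z, «split-off `…Fibres.lean` at your discretion past 400 l.»), dealer K2E5-plan (g5)
(CENSUS-41 row Φ6), prover K2E5-p16 (g4).  THEOREMS ONLY (no `def`, no instance, no notation, no named-fact hypothesis, no `sorry`, default
heartbeats); Mathlib + ★ DEFS leaf `K2LiuHermTwoGammaDefs` only; lane `--supports stmt-HodgeConjecture-24832 --as helper` (count-neutral helper).

SET-UP.  `y = [[p, w],[w̄, q]]` is fixed through the implicit reals `p q` and `w : ℂ`; the integrand `f s (a, z, b) = e^{−tr(x y)} (det x)^{s−2}`,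
`tr(x y) = ap + bq + 2 Re(z w̄)`, `det x = ab − |z|²` (★ `trace_hermTwo_mul_hermTwo`, ★ `det_hermTwo`), and the cone `D = {0 < a ∧ |z|² < ab}`
(★ `setOf_posDef_hermTwo`) enter as section VARIABLES `f`, `D` together with their defining equations `hf`, `hD` (so that this helper file declares
no `def`); the heads file `K2LiuHermTwoGammaSiegelGindikin.lean` instantiates them with `rfl`.

WHAT IS PROVED (Fubini in the order `b` (inner), `z`, `a`; all for `0 < q`, `0 < a`, `1 < re s` unless stated):
* `integral_Ioi_comp_add` — translation on a half-line, `∫_{(0,∞)} g(t + m) dt = ∫_{(m,∞)} g`;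
* `measurable_indicator` — measurability of the truncated integrand `1_D · f s` on `ℝ × ℂ × ℝ`;
* LEVEL 1 `integral_fibre_b` (+ `fibre_b_ne_zero`): the `b`-fibre lives on `b > |z|²/a`; the shift `b = |z|²/a + t` makes it the Gamma
  integral `∫₀^∞ (a t)^{s−2} e^{−q t} dt` (★ `Complex.integral_cpow_mul_exp_neg_mul_Ioi`): value `e^{−(ap + q|z|²/a + 2Re(z w̄))} a^{s−2} q^{1−s} Γ(s−1) ≠ 0`;
* LEVEL 2 `integral_fibre_z` (+ `fibre_z_ne_zero`): the Gaussian `∫_ℂ e^{−(q/a)|z|² − 2⟨w, z⟩} dz = (π a/q) e^{a|w|²/q}`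
  (★ `GaussianFourier.integral_cexp_neg_mul_sq_norm_add` on the real inner-product space `ℂ`, ★ `Complex.finrank_real_complex`, ★ `Complex.inner`):
  value `π Γ(s−1) q^{−s} · a^{s−1} e^{−(p − |w|²/q) a} ≠ 0`;
* LEVEL 3 (scalar part) `integral_fibre_a` (+ `final_ne_zero`): `∫₀^∞ a^{s−1} e^{−(p − |w|²/q) a} da = Γ(s)(p − |w|²/q)^{−s}` and
  `q^{−s}(p − |w|²/q)^{−s} = (pq − |w|²)^{−s}`: value `Γ₂(s)(pq − |w|²)^{−s} ≠ 0` (`|w|² < pq`);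
* `norm_indicator_eq` — `‖(1_D f s)(c)‖ = Re (1_D f (re s))(c)`: the norm of the integrand is the integrand at the real exponent;
* `integrable_fibre_zb` ∕ `integral_fibre_zb` — for `a > 0` the `(z, b)`-fibre is INTEGRABLE on `ℂ × ℝ` and equals the level-2 value
  (★ `integrable_prod_iff`: each `b`-fibre is integrable because its integral is the nonzero closed form — ★ `Integrable.of_integral_ne_zero` —
  and `z ↦ ∫‖·‖ db` is the real part of the level-1 closed form at `re s`, integrable for the same reason one level up).
The assembly over `a` (integrability on `ℝ × ℂ × ℝ`, the value `Γ₂(s)(det y)^{−s}`, the matrix-form heads, holomorphy) is the heads file.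

HONEST LABEL.  Count-neutral helper of the K2_Liu road; it pays no socket by itself: `HC_CM` is proved only modulo the 7 printed citations
(2 remaining named inputs: hLiu418 = `stmt-HodgeConjecture-24832`, h413 = `stmt-HodgeConjecture-24833`) until rung 0 closes.
References (orientation only): [Shimura1982] §1 (1.16) Case II; Faraut–Korányi, *Analysis on Symmetric Cones*, Thm. VII.1.1.
-/

set_option autoImplicit false
-- the mandated namespace repeats the single-problem summit's segment (`HodgeConjecture.HodgeConjecture`)
set_option linter.dupNamespace false

noncomputable section

open Complex MeasureTheory Set
open scoped ComplexOrder ComplexConjugate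

namespace Summit.HodgeConjecture.HodgeConjecture.Cruxes.HLiu418.K2LiuHermTwoSiegelGindikinFibres

open Summit.HodgeConjecture.HodgeConjecture.Cruxes.HLiu418.K2LiuHermTwoGammaDefs

/-! ## A translation lemma on a half-line -/

/-- Translation invariance of Lebesgue measure on a half-line: `∫_{(0,∞)} g(t + m) dt = ∫_{(m,∞)} g(b) db`. -/
theorem integral_Ioi_comp_add (g : ℝ → ℂ) (m : ℝ) :
    ∫ t in Ioi (0 : ℝ), g (t + m) = ∫ b in Ioi m, g b := by
  rw [← integral_indicator measurableSet_Ioi, ← integral_indicator measurableSet_Ioi]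
  have h : (Ioi (0 : ℝ)).indicator (fun t => g (t + m)) = fun t => (Ioi m).indicator g (t + m) := by
    funext t
    by_cases ht : t ∈ Ioi (0 : ℝ)
    · rw [indicator_of_mem ht, indicator_of_mem (show t + m ∈ Ioi m by simpa using ht)]
    · rw [indicator_of_notMem ht, indicator_of_notMem (show t + m ∉ Ioi m by simpa using ht)]
  rw [h]
  exact integral_add_right_eq_self (fun b => (Ioi m).indicator g b) m

/-! ## The computation in coordinates

Throughout this section `y = [[p, w],[w̄, q]]` is fixed, `f s` is the integrand `e^{−tr(x y)} (det x)^{s−2}` written in the chart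
`x = hermTwo (a, z, b)` (introduced as a variable `f` with its defining equation `hf`, so that no auxiliary `def` is needed), and `D` is
the positive cone `{0 < a ∧ |z|² < a·b}` (variable `D`, equation `hD`). -/

section Coordinates

variable {p q : ℝ} {w : ℂ}
variable (f : ℂ → ℝ × ℂ × ℝ → ℂ)
  (hf : ∀ (s : ℂ) (c : ℝ × ℂ × ℝ), f s c =
    cexp (-((c.1 * p + c.2.2 * q + 2 * (c.2.1 * conj w).re : ℝ) : ℂ)) *
      ((c.1 * c.2.2 - normSq c.2.1 : ℝ) : ℂ) ^ (s - 2))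
variable (D : Set (ℝ × ℂ × ℝ)) (hD : D = {c | 0 < c.1 ∧ normSq c.2.1 < c.1 * c.2.2})

include hf hD in
/-- Measurability of the (cone-truncated) integrand. -/
theorem measurable_indicator (s : ℂ) : Measurable (D.indicator (f s)) := by
  have hfs : f s = fun c : ℝ × ℂ × ℝ =>
      cexp (-((c.1 * p + c.2.2 * q + 2 * (c.2.1 * conj w).re : ℝ) : ℂ)) *
        ((c.1 * c.2.2 - normSq c.2.1 : ℝ) : ℂ) ^ (s - 2) := funext (hf s)
  have hDm : MeasurableSet D := by
    rw [hD, setOf_and]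
    exact (measurableSet_lt measurable_const measurable_fst).inter
      (measurableSet_lt (Complex.continuous_normSq.measurable.comp measurable_snd.fst)
        (measurable_fst.mul measurable_snd.snd))
  rw [hfs]
  refine Measurable.indicator (Measurable.mul ?_ ?_) hDm
  · have hc : Continuous fun c : ℝ × ℂ × ℝ => c.1 * p + c.2.2 * q + 2 * (c.2.1 * conj w).re := by fun_prop
    exact Complex.measurable_exp.comp (Complex.measurable_ofReal.comp hc.measurable).neg
  · have hc : Continuous fun c : ℝ × ℂ × ℝ => c.1 * c.2.2 - normSq c.2.1 := by fun_prop
    exact (Complex.measurable_ofReal.comp hc.measurable).pow_const _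

/-! ### Level 1: the fibre in `b` (a shifted Gamma integral) -/

include hf hD in
/-- The `b`-fibre of the truncated integrand over `a > 0`, `z` fixed: substituting `b = |z|²/a + t`,
`∫ e^{−tr} det^{s−2} db = e^{−(ap + q|z|²/a + 2Re(z w̄))} · a^{s−2} · q^{1−s} Γ(s−1)`. -/
theorem integral_fibre_b (hq : 0 < q) {s : ℂ} (hs : 1 < s.re) {a : ℝ} (ha : 0 < a) (z : ℂ) :
    ∫ b : ℝ, D.indicator (f s) (a, z, b) =
      cexp (-((a * p + normSq z / a * q + 2 * (z * conj w).re : ℝ) : ℂ)) * (a : ℂ) ^ (s - 2) *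
        ((1 / (q : ℂ)) ^ (s - 1) * Complex.Gamma (s - 1)) := by
  have h1 : (fun b : ℝ => D.indicator (f s) (a, z, b)) =
      (Ioi (normSq z / a)).indicator (fun b => f s (a, z, b)) := by
    funext b
    by_cases hb : normSq z / a < b
    · have hmem : (a, z, b) ∈ D := by
        rw [hD]
        exact ⟨ha, by rw [mul_comm]; exact (div_lt_iff₀ ha).mp hb⟩
      rw [indicator_of_mem hmem, indicator_of_mem (show b ∈ Ioi _ from hb)]
    · have hnmem : (a, z, b) ∉ D := by
        rw [hD]
        rintro ⟨-, h⟩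
        exact hb ((div_lt_iff₀ ha).mpr (by rw [mul_comm]; exact h))
      rw [indicator_of_notMem hnmem, indicator_of_notMem (show b ∉ Ioi _ from hb)]
  rw [h1, integral_indicator measurableSet_Ioi, ← integral_Ioi_comp_add]
  have h2 : EqOn (fun t : ℝ => f s (a, z, t + normSq z / a))
      (fun t : ℝ => cexp (-((a * p + normSq z / a * q + 2 * (z * conj w).re : ℝ) : ℂ)) * (a : ℂ) ^ (s - 2) *
        ((t : ℂ) ^ (s - 1 - 1) * cexp (-(q * t)))) (Ioi 0) := by
    intro t ht
    have ht' : 0 ≤ t := le_of_lt ht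
    simp only [hf]
    have hdet : a * (t + normSq z / a) - normSq z = a * t := by
      field_simp
      ring
    have htr : ((a * p + (t + normSq z / a) * q + 2 * (z * conj w).re : ℝ) : ℂ) =
        ((a * p + normSq z / a * q + 2 * (z * conj w).re : ℝ) : ℂ) + (q : ℂ) * (t : ℂ) := by
      push_cast
      ring
    rw [hdet, htr, neg_add, Complex.exp_add, show s - 1 - 1 = s - 2 by ring, Complex.ofReal_mul,
      mul_cpow_ofReal_nonneg ha.le ht']
    ring
  rw [setIntegral_congr_fun measurableSet_Ioi h2, integral_const_mul,
    integral_cpow_mul_exp_neg_mul_Ioi (by simp only [sub_re, one_re]; linarith) hq]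

/-- The closed form of the `b`-fibre is nonzero. -/
theorem fibre_b_ne_zero (hq : 0 < q) {s : ℂ} (hs : 1 < s.re) {a : ℝ} (ha : 0 < a) (z : ℂ) :
    cexp (-((a * p + normSq z / a * q + 2 * (z * conj w).re : ℝ) : ℂ)) * (a : ℂ) ^ (s - 2) *
        ((1 / (q : ℂ)) ^ (s - 1) * Complex.Gamma (s - 1)) ≠ 0 := by
  have h1 : (a : ℂ) ^ (s - 2) ≠ 0 := by
    rw [Ne, cpow_eq_zero_iff, not_and_or]
    exact Or.inl (ofReal_ne_zero.mpr ha.ne')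
  have h2 : (1 / (q : ℂ)) ^ (s - 1) ≠ 0 := by
    rw [Ne, cpow_eq_zero_iff, not_and_or]
    exact Or.inl (one_div_ne_zero (ofReal_ne_zero.mpr hq.ne'))
  have h3 : Complex.Gamma (s - 1) ≠ 0 :=
    Complex.Gamma_ne_zero_of_re_pos (by simp only [sub_re, one_re]; linarith)
  exact mul_ne_zero (mul_ne_zero (Complex.exp_ne_zero _) h1) (mul_ne_zero h2 h3)

/-! ### Level 2: the fibre in `z` (a Gaussian over `ℂ ≅ ℝ²`) -/

/-- Integrating the closed form of the `b`-fibre over `z ∈ ℂ` (a Gaussian with a linear term, `finrank ℝ ℂ = 2`):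
the result is `π Γ(s−1) q^{−s} · a^{s−1} e^{−(p − |w|²/q) a}`. -/
theorem integral_fibre_z (hq : 0 < q) (s : ℂ) {a : ℝ} (ha : 0 < a) :
    ∫ z : ℂ, cexp (-((a * p + normSq z / a * q + 2 * (z * conj w).re : ℝ) : ℂ)) * (a : ℂ) ^ (s - 2) *
        ((1 / (q : ℂ)) ^ (s - 1) * Complex.Gamma (s - 1)) =
      (Real.pi : ℂ) * Complex.Gamma (s - 1) * (1 / (q : ℂ)) ^ (s - 1) * (1 / (q : ℂ)) *
        ((a : ℂ) ^ (s - 1) * cexp (-((p - normSq w / q : ℝ) * a))) := by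
  have hqa : 0 < q / a := div_pos hq ha
  have ha0 : (a : ℂ) ≠ 0 := ofReal_ne_zero.mpr ha.ne'
  have hq0 : (q : ℂ) ≠ 0 := ofReal_ne_zero.mpr hq.ne'
  have hpt : ∀ z : ℂ,
      cexp (-((a * p + normSq z / a * q + 2 * (z * conj w).re : ℝ) : ℂ)) * (a : ℂ) ^ (s - 2) *
          ((1 / (q : ℂ)) ^ (s - 1) * Complex.Gamma (s - 1)) =
        (cexp (-((a * p : ℝ) : ℂ)) * (a : ℂ) ^ (s - 2) * ((1 / (q : ℂ)) ^ (s - 1) * Complex.Gamma (s - 1))) *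
          cexp (-((q / a : ℝ) : ℂ) * (‖z‖ : ℂ) ^ 2 + (-2) * (inner ℝ w z : ℝ)) := by
    intro z
    rw [Complex.inner w z]
    have hexp : cexp (-((a * p + normSq z / a * q + 2 * (z * conj w).re : ℝ) : ℂ)) =
        cexp (-((a * p : ℝ) : ℂ)) *
          cexp (-((q / a : ℝ) : ℂ) * (‖z‖ : ℂ) ^ 2 + (-2) * ((z * conj w).re : ℝ)) := by
      rw [← Complex.exp_add, Complex.normSq_eq_norm_sq]
      congr 1
      push_cast
      field_simp
      ring
    rw [hexp]
    ring
  simp_rw [hpt]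
  rw [integral_const_mul, GaussianFourier.integral_cexp_neg_mul_sq_norm_add (by simpa using hqa) (-2) w]
  have h22 : ((Module.finrank ℝ ℂ : ℂ) / 2) = 1 := by
    rw [Complex.finrank_real_complex]
    norm_num
  rw [h22, cpow_one]
  have hpow : (a : ℂ) ^ (s - 1) = (a : ℂ) ^ (s - 2) * a := by
    rw [show s - 1 = s - 2 + 1 by ring, cpow_add _ _ ha0, cpow_one]
  have hexp2 : cexp (-((a * p : ℝ) : ℂ)) * cexp ((-2) ^ 2 * (‖w‖ : ℂ) ^ 2 / (4 * ((q / a : ℝ) : ℂ))) =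
      cexp (-((p - normSq w / q : ℝ) * a)) := by
    rw [← Complex.exp_add, Complex.normSq_eq_norm_sq]
    congr 1
    push_cast
    field_simp
    ring
  rw [hpow, ← hexp2]
  generalize (a : ℂ) ^ (s - 2) = A
  generalize (1 / (q : ℂ)) ^ (s - 1) = Q
  push_cast
  field_simp

/-- The closed form of the `z`-fibre is nonzero. -/
theorem fibre_z_ne_zero (hq : 0 < q) {s : ℂ} (hs : 1 < s.re) {a : ℝ} (ha : 0 < a) :
    (Real.pi : ℂ) * Complex.Gamma (s - 1) * (1 / (q : ℂ)) ^ (s - 1) * (1 / (q : ℂ)) *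
        ((a : ℂ) ^ (s - 1) * cexp (-((p - normSq w / q : ℝ) * a))) ≠ 0 := by
  have hπ : (Real.pi : ℂ) ≠ 0 := ofReal_ne_zero.mpr Real.pi_pos.ne'
  have h1 : (a : ℂ) ^ (s - 1) ≠ 0 := by
    rw [Ne, cpow_eq_zero_iff, not_and_or]
    exact Or.inl (ofReal_ne_zero.mpr ha.ne')
  have h2 : (1 / (q : ℂ)) ^ (s - 1) ≠ 0 := by
    rw [Ne, cpow_eq_zero_iff, not_and_or]
    exact Or.inl (one_div_ne_zero (ofReal_ne_zero.mpr hq.ne'))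
  have h3 : Complex.Gamma (s - 1) ≠ 0 :=
    Complex.Gamma_ne_zero_of_re_pos (by simp only [sub_re, one_re]; linarith)
  have h4 : (1 / (q : ℂ)) ≠ 0 := one_div_ne_zero (ofReal_ne_zero.mpr hq.ne')
  exact mul_ne_zero (mul_ne_zero (mul_ne_zero (mul_ne_zero hπ h3) h2) h4) (mul_ne_zero h1 (Complex.exp_ne_zero _))

/-! ### Level 3: the fibre in `a` (a Gamma integral) -/

/-- Integrating the closed form of the `z`-fibre over `a > 0`: `π Γ(s) Γ(s−1) · (pq − |w|²)^{−s}`. -/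
theorem integral_fibre_a (hq : 0 < q) (hpq : normSq w < p * q) {s : ℂ} (hs : 1 < s.re) :
    ∫ a in Ioi (0 : ℝ), (Real.pi : ℂ) * Complex.Gamma (s - 1) * (1 / (q : ℂ)) ^ (s - 1) * (1 / (q : ℂ)) *
        ((a : ℂ) ^ (s - 1) * cexp (-((p - normSq w / q : ℝ) * a))) =
      hermTwoGamma s * ((p * q - normSq w : ℝ) : ℂ) ^ (-s) := by
  have hr : 0 < p - normSq w / q := by
    rw [sub_pos, div_lt_iff₀ hq]
    exact hpq
  have hdet : 0 < p * q - normSq w := by linarith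
  have hq0 : (q : ℂ) ≠ 0 := ofReal_ne_zero.mpr hq.ne'
  rw [integral_const_mul, integral_cpow_mul_exp_neg_mul_Ioi (by linarith : 0 < s.re) hr, hermTwoGamma_def]
  have h1 : (1 / (q : ℂ)) ^ (s - 1) * (1 / (q : ℂ)) = (1 / (q : ℂ)) ^ s := by
    conv_rhs => rw [show s = s - 1 + 1 by ring, cpow_add _ _ (one_div_ne_zero hq0), cpow_one]
  have harg : ((p * q - normSq w : ℝ) : ℂ).arg ≠ Real.pi := by
    rw [arg_ofReal_of_nonneg hdet.le]
    exact Real.pi_pos.ne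
  have h2 : (1 / (q : ℂ)) ^ s * (1 / ((p - normSq w / q : ℝ) : ℂ)) ^ s =
      ((p * q - normSq w : ℝ) : ℂ) ^ (-s) := by
    rw [cpow_neg, ← inv_cpow _ _ harg, ← one_div,
      show (1 / (q : ℂ)) = ((1 / q : ℝ) : ℂ) by push_cast; ring,
      show (1 / ((p - normSq w / q : ℝ) : ℂ)) = ((1 / (p - normSq w / q) : ℝ) : ℂ) by push_cast; ring,
      show (1 / ((p * q - normSq w : ℝ) : ℂ)) = ((1 / (p * q - normSq w) : ℝ) : ℂ) by push_cast; ring,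
      ← mul_cpow_ofReal_nonneg (by positivity) (by positivity)]
    congr 1
    have hq' : q ≠ 0 := hq.ne'
    have hr' : p - normSq w / q ≠ 0 := hr.ne'
    have hd' : p * q - normSq w ≠ 0 := hdet.ne'
    push_cast
    field_simp
  calc (Real.pi : ℂ) * Complex.Gamma (s - 1) * (1 / (q : ℂ)) ^ (s - 1) * (1 / (q : ℂ)) *
        ((1 / ((p - normSq w / q : ℝ) : ℂ)) ^ s * Complex.Gamma s)
      = (Real.pi : ℂ) * Complex.Gamma s * Complex.Gamma (s - 1) *
          (((1 / (q : ℂ)) ^ (s - 1) * (1 / (q : ℂ))) * (1 / ((p - normSq w / q : ℝ) : ℂ)) ^ s) := by ring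
    _ = (Real.pi : ℂ) * Complex.Gamma s * Complex.Gamma (s - 1) * ((p * q - normSq w : ℝ) : ℂ) ^ (-s) := by
          rw [h1, h2]

/-- The final closed form is nonzero. -/
theorem final_ne_zero (hpq : normSq w < p * q) {s : ℂ} (hs : 1 < s.re) :
    hermTwoGamma s * ((p * q - normSq w : ℝ) : ℂ) ^ (-s) ≠ 0 := by
  have hdet : 0 < p * q - normSq w := by linarith
  refine mul_ne_zero (hermTwoGamma_ne_zero hs) ?_
  rw [Ne, cpow_eq_zero_iff, not_and_or]
  exact Or.inl (ofReal_ne_zero.mpr hdet.ne')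

/-! ### The norm of the integrand is the integrand at the real exponent `re s` -/

include hf hD in
/-- `‖e^{−tr} det^{s−2}‖ = e^{−tr} det^{re s − 2}` on the cone: the norm of the truncated integrand at `s` is the (real part of
the) truncated integrand at the real exponent `re s`. -/
theorem norm_indicator_eq (s : ℂ) (c : ℝ × ℂ × ℝ) :
    ‖D.indicator (f s) c‖ = (D.indicator (f (s.re : ℂ)) c).re := by
  by_cases hc : c ∈ D
  · rw [indicator_of_mem hc, indicator_of_mem hc, hf, hf]
    have hc' : 0 < c.1 ∧ normSq c.2.1 < c.1 * c.2.2 := by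
      rw [hD] at hc
      exact hc
    have hdet : 0 < c.1 * c.2.2 - normSq c.2.1 := by linarith [hc'.2]
    rw [norm_mul, Complex.norm_exp, norm_cpow_eq_rpow_re_of_pos hdet,
      show ((s.re : ℂ) - 2) = ((s.re - 2 : ℝ) : ℂ) by push_cast; ring, ← ofReal_cpow hdet.le, ← ofReal_neg,
      ← ofReal_exp, ← ofReal_mul, ofReal_re, ofReal_re]
    simp
  · rw [indicator_of_notMem hc, indicator_of_notMem hc, norm_zero, Complex.zero_re]

/-! ### Fubini, level 2: integrability and value of the `(z, b)`-fibre -/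

include hf hD in
/-- For `a > 0` the `(z, b)`-fibre of the truncated integrand is integrable on `ℂ × ℝ` (Fubini–Tonelli via `integrable_prod_iff`:
each `b`-fibre is integrable because its integral is the nonzero closed form, and `z ↦ ∫ ‖·‖ db` is the real part of the closed form at
the real exponent `re s`, itself integrable because ITS integral is the nonzero Gaussian closed form). -/
theorem integrable_fibre_zb (hq : 0 < q) {s : ℂ} (hs : 1 < s.re) {a : ℝ} (ha : 0 < a) :
    Integrable (fun zb : ℂ × ℝ => D.indicator (f s) (a, zb)) ((volume : Measure ℂ).prod (volume : Measure ℝ)) := by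
  have hσ : 1 < ((s.re : ℂ)).re := by simpa using hs
  have hm : Measurable (fun zb : ℂ × ℝ => D.indicator (f s) (a, zb)) :=
    (measurable_indicator f hf D hD s).comp measurable_prodMk_left
  rw [integrable_prod_iff hm.aestronglyMeasurable]
  refine ⟨Filter.Eventually.of_forall fun z => Integrable.of_integral_ne_zero ?_, ?_⟩
  · rw [show (∫ b : ℝ, (fun zb : ℂ × ℝ => D.indicator (f s) (a, zb)) (z, b)) = ∫ b : ℝ, D.indicator (f s) (a, z, b) from rfl,
      integral_fibre_b f hf D hD hq hs ha z]
    exact fibre_b_ne_zero hq hs ha z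
  · have hre : (fun z : ℂ => ∫ b : ℝ, ‖(fun zb : ℂ × ℝ => D.indicator (f s) (a, zb)) (z, b)‖) =
        fun z => (cexp (-((a * p + normSq z / a * q + 2 * (z * conj w).re : ℝ) : ℂ)) * (a : ℂ) ^ ((s.re : ℂ) - 2) *
          ((1 / (q : ℂ)) ^ ((s.re : ℂ) - 1) * Complex.Gamma ((s.re : ℂ) - 1))).re := by
      funext z
      rw [← integral_fibre_b f hf D hD hq hσ ha z]
      have hint : Integrable (fun b : ℝ => D.indicator (f (s.re : ℂ)) (a, z, b)) :=
        Integrable.of_integral_ne_zero (by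
          rw [integral_fibre_b f hf D hD hq hσ ha z]
          exact fibre_b_ne_zero hq hσ ha z)
      have h1 := Complex.reCLM.integral_comp_comm hint
      simp only [Complex.reCLM_apply] at h1
      rw [← h1]
      exact integral_congr_ae (Filter.Eventually.of_forall fun b => norm_indicator_eq f hf D hD s (a, z, b))
    rw [hre]
    have hint2 : Integrable (fun z : ℂ => cexp (-((a * p + normSq z / a * q + 2 * (z * conj w).re : ℝ) : ℂ)) *
        (a : ℂ) ^ ((s.re : ℂ) - 2) * ((1 / (q : ℂ)) ^ ((s.re : ℂ) - 1) * Complex.Gamma ((s.re : ℂ) - 1))) :=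
      Integrable.of_integral_ne_zero (by
        rw [integral_fibre_z hq _ ha]
        exact fibre_z_ne_zero hq hσ ha)
    have h3 := hint2.re
    simpa using h3

include hf hD in
/-- For `a > 0`, the value of the `(z, b)`-fibre: `∫∫ e^{−tr} det^{s−2} dz db = π Γ(s−1) q^{−s} a^{s−1} e^{−(p − |w|²/q) a}`. -/
theorem integral_fibre_zb (hq : 0 < q) {s : ℂ} (hs : 1 < s.re) {a : ℝ} (ha : 0 < a) :
    ∫ zb : ℂ × ℝ, D.indicator (f s) (a, zb) =
      (Real.pi : ℂ) * Complex.Gamma (s - 1) * (1 / (q : ℂ)) ^ (s - 1) * (1 / (q : ℂ)) *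
        ((a : ℂ) ^ (s - 1) * cexp (-((p - normSq w / q : ℝ) * a))) := by
  rw [Measure.volume_eq_prod, integral_prod _ (integrable_fibre_zb f hf D hD hq hs ha)]
  have h1 : (fun z : ℂ => ∫ b : ℝ, D.indicator (f s) (a, (z, b))) =
      fun z => cexp (-((a * p + normSq z / a * q + 2 * (z * conj w).re : ℝ) : ℂ)) * (a : ℂ) ^ (s - 2) *
        ((1 / (q : ℂ)) ^ (s - 1) * Complex.Gamma (s - 1)) :=
    funext fun z => integral_fibre_b f hf D hD hq hs ha z
  rw [h1]
  exact integral_fibre_z hq s ha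


end Coordinates

end Summit.HodgeConjecture.HodgeConjecture.Cruxes.HLiu418.K2LiuHermTwoSiegelGindikinFibres

end
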